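import Mathlib.Analysis.SpecialFunctions.Complex.Arg
import Mathlib.Analysis.SpecialFunctions.Exp
import Mathlib.Analysis.SpecialFunctions.Pow.Real
import Mathlib.Analysis.SpecialFunctions.Trigonometric.Bounds
import Mathlib.Analysis.Complex.ExponentialBounds
import Mathlib.Analysis.Real.Pi.Bounds
import Mathlib.Algebra.Order.Round
import Mathlib.RingTheory.MvPolynomial.Homogeneous
import Literature.NumberTheory.Transcendental.HypersurfaceCover
import Literature.FieldTheory.QuasiAlgClosed.Basic
import HarnessLib

/-!
# Lemmas for EC by escape to infinity over graph bases of arbitrary degree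

Estimates for `ZilberEacComplexGraphEscape.lean` (EAC, first open rung `dim π₁(V) = n - 1`,
Mantova–Masser, PLMS 129 (2024), §1 p. 5; escape over a graph base `x_{s+1} = g(x')` of ANY degree):
`exists_norm_eval_add_sub_eval_le` (polynomial increments), `exists_norm_eval_ray_sub_le`
(**expansion along a complex ray** `‖g(τκ + w) - τᴰ g_D(κ)‖ ≤ C (1 + ‖w‖)ᴺ ‖τ‖^{D-1}`),
`exists_sign_arg_root` (sign `σ = ±1` and angle `|θ₀| ≤ π/(2D)` with `α (e^{iθ₀})ᴰ = iσ‖α‖`),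
`re_escape_ge` / `norm_escape_le` (`τ = r e^{iθ₀} e^{η/D}`, `‖η‖ ≤ 1`: `Re τ ≥ r/12`, `r/2 ≤ ‖τ‖ ≤ 2r`).
HONEST FRAMING: auxiliary estimates for a modest sub-rung of EAC; nothing bears on Schanuel's conjecture.
-/

noncomputable section

open Complex MvPolynomial Metric Set Filter Topology

set_option linter.dupNamespace false

namespace Summit.Schanuel.Schanuel.Theorems

/-! ### Polynomial increments and the expansion along a complex ray -/

/-- **Increment bound for polynomials.** For `p ∈ ℂ[x₁..xₛ]` there are `C ≥ 0`, `N` with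
`‖p(a + u) - p(a)‖ ≤ C ‖u‖ (1 + ‖a‖)ᴺ (1 + ‖u‖)ᴺ` for all `a, u ∈ ℂˢ` (sup norm); induction on `p`.
[folklore] -/
theorem exists_norm_eval_add_sub_eval_le {s : ℕ} (p : MvPolynomial (Fin s) ℂ) :
    ∃ C : ℝ, 0 ≤ C ∧ ∃ N : ℕ, ∀ a u : Fin s → ℂ,
      ‖eval (a + u) p - eval a p‖ ≤ C * ‖u‖ * (1 + ‖a‖) ^ N * (1 + ‖u‖) ^ N := by
  induction p using MvPolynomial.induction_on with
  | C c => exact ⟨0, le_rfl, 0, fun a u => by simp⟩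
  | add p q hp hq =>
    obtain ⟨C₁, hC₁, N₁, h₁⟩ := hp
    obtain ⟨C₂, hC₂, N₂, h₂⟩ := hq
    refine ⟨C₁ + C₂, add_nonneg hC₁ hC₂, max N₁ N₂, fun a u => ?_⟩
    have ha : 1 ≤ 1 + ‖a‖ := le_add_of_nonneg_right (norm_nonneg _)
    have hu : 1 ≤ 1 + ‖u‖ := le_add_of_nonneg_right (norm_nonneg _)
    have key : ∀ {C : ℝ} {N : ℕ}, 0 ≤ C → N ≤ max N₁ N₂ →
        C * ‖u‖ * (1 + ‖a‖) ^ N * (1 + ‖u‖) ^ N ≤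
          C * ‖u‖ * (1 + ‖a‖) ^ max N₁ N₂ * (1 + ‖u‖) ^ max N₁ N₂ := by
      intro C N hC hN
      have e1 : (1 + ‖a‖) ^ N ≤ (1 + ‖a‖) ^ max N₁ N₂ := pow_le_pow_right₀ ha hN
      have e2 : (1 + ‖u‖) ^ N ≤ (1 + ‖u‖) ^ max N₁ N₂ := pow_le_pow_right₀ hu hN
      have h0 : 0 ≤ C * ‖u‖ := mul_nonneg hC (norm_nonneg _)
      exact mul_le_mul (mul_le_mul_of_nonneg_left e1 h0) e2 (by positivity) (by positivity)
    rw [map_add, map_add, add_sub_add_comm]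
    refine (norm_add_le _ _).trans ?_
    calc ‖eval (a + u) p - eval a p‖ + ‖eval (a + u) q - eval a q‖
        ≤ C₁ * ‖u‖ * (1 + ‖a‖) ^ max N₁ N₂ * (1 + ‖u‖) ^ max N₁ N₂ +
            C₂ * ‖u‖ * (1 + ‖a‖) ^ max N₁ N₂ * (1 + ‖u‖) ^ max N₁ N₂ :=
          add_le_add ((h₁ a u).trans (key hC₁ (le_max_left _ _)))
            ((h₂ a u).trans (key hC₂ (le_max_right _ _)))
      _ = (C₁ + C₂) * ‖u‖ * (1 + ‖a‖) ^ max N₁ N₂ * (1 + ‖u‖) ^ max N₁ N₂ := by ring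
  | mul_X p i hp =>
    obtain ⟨C, hC, N, h⟩ := hp
    obtain ⟨Cp, hCp, Dp, hp'⟩ :=
      Literature.NumberTheory.Transcendental.HypersurfaceCover.exists_norm_eval_le_pow p
    refine ⟨C + Cp, add_nonneg hC hCp, max (N + 1) Dp, fun a u => ?_⟩
    set M := max (N + 1) Dp with hM
    have ha : 1 ≤ 1 + ‖a‖ := le_add_of_nonneg_right (norm_nonneg _)
    have hu : 1 ≤ 1 + ‖u‖ := le_add_of_nonneg_right (norm_nonneg _)
    rw [map_mul, map_mul, eval_X, eval_X, Pi.add_apply]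
    have eq : eval (a + u) p * (a i + u i) - eval a p * a i =
        (eval (a + u) p - eval a p) * (a i + u i) + eval a p * u i := by ring
    rw [eq]
    have hai : ‖a i + u i‖ ≤ (1 + ‖a‖) * (1 + ‖u‖) := by
      have h1 : ‖a i‖ ≤ ‖a‖ := norm_le_pi_norm a i
      have h2 : ‖u i‖ ≤ ‖u‖ := norm_le_pi_norm u i
      have h3 := norm_add_le (a i) (u i)
      nlinarith [norm_nonneg a, norm_nonneg u, norm_nonneg (a i), norm_nonneg (u i)]
    have hui : ‖u i‖ ≤ ‖u‖ := norm_le_pi_norm u i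
    have t1 : ‖(eval (a + u) p - eval a p) * (a i + u i)‖ ≤
        C * ‖u‖ * (1 + ‖a‖) ^ M * (1 + ‖u‖) ^ M := by
      rw [norm_mul]
      calc ‖eval (a + u) p - eval a p‖ * ‖a i + u i‖
          ≤ (C * ‖u‖ * (1 + ‖a‖) ^ N * (1 + ‖u‖) ^ N) * ((1 + ‖a‖) * (1 + ‖u‖)) :=
            mul_le_mul (h a u) hai (norm_nonneg _) (by positivity)
        _ = C * ‖u‖ * (1 + ‖a‖) ^ (N + 1) * (1 + ‖u‖) ^ (N + 1) := by ring
        _ ≤ C * ‖u‖ * (1 + ‖a‖) ^ M * (1 + ‖u‖) ^ M := by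
            have e1 : (1 + ‖a‖) ^ (N + 1) ≤ (1 + ‖a‖) ^ M :=
              pow_le_pow_right₀ ha (le_max_left _ _)
            have e2 : (1 + ‖u‖) ^ (N + 1) ≤ (1 + ‖u‖) ^ M :=
              pow_le_pow_right₀ hu (le_max_left _ _)
            have h0 : 0 ≤ C * ‖u‖ := mul_nonneg hC (norm_nonneg _)
            exact mul_le_mul (mul_le_mul_of_nonneg_left e1 h0) e2 (by positivity)
              (by positivity)
    have t2 : ‖eval a p * u i‖ ≤ Cp * ‖u‖ * (1 + ‖a‖) ^ M * (1 + ‖u‖) ^ M := by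
      rw [norm_mul]
      calc ‖eval a p‖ * ‖u i‖ ≤ Cp * (1 + ‖a‖) ^ Dp * ‖u‖ :=
            mul_le_mul (hp' a) hui (norm_nonneg _) (by positivity)
        _ ≤ Cp * (1 + ‖a‖) ^ M * ‖u‖ := by
            have e1 : (1 + ‖a‖) ^ Dp ≤ (1 + ‖a‖) ^ M := pow_le_pow_right₀ ha (le_max_right _ _)
            have := mul_le_mul_of_nonneg_left e1 hCp
            exact mul_le_mul_of_nonneg_right this (norm_nonneg _)
        _ = Cp * ‖u‖ * (1 + ‖a‖) ^ M * 1 := by ring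
        _ ≤ Cp * ‖u‖ * (1 + ‖a‖) ^ M * (1 + ‖u‖) ^ M :=
            mul_le_mul_of_nonneg_left (one_le_pow₀ hu) (by positivity)
    calc ‖(eval (a + u) p - eval a p) * (a i + u i) + eval a p * u i‖
        ≤ ‖(eval (a + u) p - eval a p) * (a i + u i)‖ + ‖eval a p * u i‖ := norm_add_le _ _
      _ ≤ C * ‖u‖ * (1 + ‖a‖) ^ M * (1 + ‖u‖) ^ M + Cp * ‖u‖ * (1 + ‖a‖) ^ M * (1 + ‖u‖) ^ M :=
          add_le_add t1 t2
      _ = (C + Cp) * ‖u‖ * (1 + ‖a‖) ^ M * (1 + ‖u‖) ^ M := by ring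

/-- `‖τ‖ᴰ / ‖τ‖ ≤ ‖τ‖^{D-1}` for `‖τ‖ ≥ 1` (with truncated subtraction: for `D = 0` this reads
`1/‖τ‖ ≤ 1`). [folklore] -/
theorem pow_div_self_le_pow_sub_one {t : ℝ} (ht : 1 ≤ t) (D : ℕ) :
    t ^ D / t ≤ t ^ (D - 1) := by
  have ht0 : 0 < t := by linarith
  rcases Nat.eq_zero_or_pos D with rfl | hD
  · rw [pow_zero]
    exact (div_le_one ht0).mpr ht
  · obtain ⟨D', rfl⟩ : ∃ D', D = D' + 1 := ⟨D - 1, by omega⟩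
    rw [pow_succ, mul_div_assoc, div_self ht0.ne', mul_one, Nat.add_sub_cancel]

/-- **Expansion of a polynomial along a complex ray.** For `g ∈ ℂ[x₁..xₛ]` of total degree `D`
with leading form `g_D` and `κ ∈ ℂˢ` there are `C ≥ 0`, `N` with
`‖g(τκ + w) - τᴰ g_D(κ)‖ ≤ C (1 + ‖w‖)ᴺ ‖τ‖^{D-1}` for all `τ ∈ ℂ` with `‖τ‖ ≥ 1` and all `w ∈ ℂˢ`:
the lower homogeneous components contribute `τⁱ gᵢ(κ + w/τ)`, `i < D`, and the top one
`τᴰ (g_D(κ + w/τ) - g_D(κ)) = O(‖w‖ ‖τ‖^{D-1})` by the increment bound. (Complex-ray version of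
D'Aquino–Fornasiero–Terzo 2018, Lemma 2.3.) [folklore] -/
theorem exists_norm_eval_ray_sub_le {s : ℕ} (g : MvPolynomial (Fin s) ℂ) (κ : Fin s → ℂ) :
    ∃ C : ℝ, 0 ≤ C ∧ ∃ N : ℕ, ∀ τ : ℂ, 1 ≤ ‖τ‖ → ∀ w : Fin s → ℂ,
      ‖eval (τ • κ + w) g - τ ^ g.totalDegree * eval κ (homogeneousComponent g.totalDegree g)‖ ≤
        C * (1 + ‖w‖) ^ N * ‖τ‖ ^ (g.totalDegree - 1) := by
  classical
  set D := g.totalDegree with hD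
  have hB : ∀ i : ℕ, ∃ C : ℝ, 0 ≤ C ∧ ∃ N : ℕ, ∀ z : Fin s → ℂ,
      ‖eval z (homogeneousComponent i g)‖ ≤ C * (1 + ‖z‖) ^ N := fun i =>
    Literature.NumberTheory.Transcendental.HypersurfaceCover.exists_norm_eval_le_pow _
  choose B hB0 NB hBle using hB
  obtain ⟨CL, hCL0, NL, hL⟩ := exists_norm_eval_add_sub_eval_le (homogeneousComponent D g)
  set K : ℝ := 1 + ‖κ‖ with hK
  have hK1 : 1 ≤ K := le_add_of_nonneg_right (norm_nonneg _)
  set Ntot : ℕ := (∑ i ∈ Finset.range D, NB i) + (NL + 1) with hNtot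
  have hK0 : 0 ≤ K := zero_le_one.trans hK1
  refine ⟨(∑ i ∈ Finset.range D, B i * K ^ NB i) + CL * K ^ NL,
    add_nonneg (Finset.sum_nonneg fun i _ => mul_nonneg (hB0 i) (pow_nonneg hK0 _))
      (mul_nonneg hCL0 (pow_nonneg hK0 _)), Ntot, ?_⟩
  intro τ hτ w
  have hτpos : 0 < ‖τ‖ := by linarith
  have hτ0 : τ ≠ 0 := norm_pos_iff.mp hτpos
  have hw1 : 1 ≤ 1 + ‖w‖ := le_add_of_nonneg_right (norm_nonneg _)
  set u : Fin s → ℂ := τ⁻¹ • w with hu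
  have hun : ‖u‖ = ‖w‖ / ‖τ‖ := by rw [hu, norm_smul, norm_inv, div_eq_inv_mul]
  have hule : ‖u‖ ≤ ‖w‖ := by
    rw [hun]; exact div_le_self (norm_nonneg _) hτ
  have hκu : 1 + ‖κ + u‖ ≤ K * (1 + ‖w‖) := by
    have h1 := norm_add_le κ u
    rw [hK]; nlinarith [norm_nonneg κ, norm_nonneg w, norm_nonneg u]
  -- decomposition into homogeneous components
  have hdecomp : eval (τ • κ + w) g =
      ∑ i ∈ Finset.range (D + 1), τ ^ i * eval (κ + u) (homogeneousComponent i g) := by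
    conv_lhs => rw [← sum_homogeneousComponent g]
    rw [map_sum]
    refine Finset.sum_congr rfl fun i _ => ?_
    have : τ • κ + w = τ • (κ + u) := by
      rw [hu, smul_add, smul_smul, mul_inv_cancel₀ hτ0, one_smul]
    rw [this, (homogeneousComponent_isHomogeneous i g).eval_smul_eq]
  rw [hdecomp, Finset.sum_range_succ, add_sub_assoc, ← mul_sub]
  -- the lower components
  have hlow : ‖∑ i ∈ Finset.range D, τ ^ i * eval (κ + u) (homogeneousComponent i g)‖ ≤
      (∑ i ∈ Finset.range D, B i * K ^ NB i) * (1 + ‖w‖) ^ Ntot * ‖τ‖ ^ (D - 1) := by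
    calc ‖∑ i ∈ Finset.range D, τ ^ i * eval (κ + u) (homogeneousComponent i g)‖
        ≤ ∑ i ∈ Finset.range D, ‖τ ^ i * eval (κ + u) (homogeneousComponent i g)‖ :=
          norm_sum_le _ _
      _ ≤ ∑ i ∈ Finset.range D, B i * K ^ NB i * (1 + ‖w‖) ^ Ntot * ‖τ‖ ^ (D - 1) := by
          refine Finset.sum_le_sum fun i hi => ?_
          have hi' : i ≤ D - 1 := by have := Finset.mem_range.mp hi; omega
          rw [norm_mul, norm_pow]
          have e1 : ‖τ‖ ^ i ≤ ‖τ‖ ^ (D - 1) := pow_le_pow_right₀ hτ hi'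
          have e2 : ‖eval (κ + u) (homogeneousComponent i g)‖ ≤
              B i * K ^ NB i * (1 + ‖w‖) ^ Ntot := by
            refine (hBle i (κ + u)).trans ?_
            have e3 : (1 + ‖κ + u‖) ^ NB i ≤ (K * (1 + ‖w‖)) ^ NB i :=
              pow_le_pow_left₀ (by positivity) hκu _
            rw [mul_pow] at e3
            have e4 : (1 + ‖w‖) ^ NB i ≤ (1 + ‖w‖) ^ Ntot := by
              refine pow_le_pow_right₀ hw1 ?_
              rw [hNtot]
              have := Finset.single_le_sum (f := NB) (fun i _ => Nat.zero_le _) hi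
              omega
            calc B i * (1 + ‖κ + u‖) ^ NB i ≤ B i * (K ^ NB i * (1 + ‖w‖) ^ NB i) :=
                  mul_le_mul_of_nonneg_left e3 (hB0 i)
              _ ≤ B i * (K ^ NB i * (1 + ‖w‖) ^ Ntot) := by
                  refine mul_le_mul_of_nonneg_left ?_ (hB0 i)
                  exact mul_le_mul_of_nonneg_left e4 (by positivity)
              _ = B i * K ^ NB i * (1 + ‖w‖) ^ Ntot := by ring
          calc ‖τ‖ ^ i * ‖eval (κ + u) (homogeneousComponent i g)‖
              ≤ ‖τ‖ ^ (D - 1) * (B i * K ^ NB i * (1 + ‖w‖) ^ Ntot) :=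
                mul_le_mul e1 e2 (norm_nonneg _) (by positivity)
            _ = B i * K ^ NB i * (1 + ‖w‖) ^ Ntot * ‖τ‖ ^ (D - 1) := by ring
      _ = (∑ i ∈ Finset.range D, B i * K ^ NB i) * (1 + ‖w‖) ^ Ntot * ‖τ‖ ^ (D - 1) := by
          rw [Finset.sum_mul, Finset.sum_mul]
  -- the top component
  have htop : ‖τ ^ D * (eval (κ + u) (homogeneousComponent D g) -
      eval κ (homogeneousComponent D g))‖ ≤ CL * K ^ NL * (1 + ‖w‖) ^ Ntot * ‖τ‖ ^ (D - 1) := by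
    rw [norm_mul, norm_pow]
    have e1 := hL κ u
    have e2 : (1 + ‖u‖) ^ NL ≤ (1 + ‖w‖) ^ NL :=
      pow_le_pow_left₀ (by positivity) (by linarith) _
    have e3 : (1 + ‖κ‖) ^ NL = K ^ NL := by rw [hK]
    have e4 : ‖τ‖ ^ D * ‖u‖ ≤ ‖τ‖ ^ (D - 1) * ‖w‖ := by
      rw [hun, ← mul_div_assoc, mul_comm, mul_div_assoc, mul_comm]
      exact mul_le_mul_of_nonneg_right (pow_div_self_le_pow_sub_one hτ D) (norm_nonneg _)
    have e5 : ‖w‖ * (1 + ‖w‖) ^ NL ≤ (1 + ‖w‖) ^ Ntot := by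
      calc ‖w‖ * (1 + ‖w‖) ^ NL ≤ (1 + ‖w‖) * (1 + ‖w‖) ^ NL :=
            mul_le_mul_of_nonneg_right (by linarith) (by positivity)
        _ = (1 + ‖w‖) ^ (NL + 1) := by ring
        _ ≤ (1 + ‖w‖) ^ Ntot := pow_le_pow_right₀ hw1 (by rw [hNtot]; omega)
    calc ‖τ‖ ^ D * ‖eval (κ + u) (homogeneousComponent D g) - eval κ (homogeneousComponent D g)‖
        ≤ ‖τ‖ ^ D * (CL * ‖u‖ * (1 + ‖κ‖) ^ NL * (1 + ‖u‖) ^ NL) :=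
          mul_le_mul_of_nonneg_left e1 (by positivity)
      _ ≤ ‖τ‖ ^ D * (CL * ‖u‖ * (1 + ‖κ‖) ^ NL * (1 + ‖w‖) ^ NL) := by
          refine mul_le_mul_of_nonneg_left ?_ (by positivity)
          exact mul_le_mul_of_nonneg_left e2 (by positivity)
      _ = CL * K ^ NL * ((‖τ‖ ^ D * ‖u‖) * (1 + ‖w‖) ^ NL) := by rw [e3]; ring
      _ ≤ CL * K ^ NL * ((‖τ‖ ^ (D - 1) * ‖w‖) * (1 + ‖w‖) ^ NL) := by
          refine mul_le_mul_of_nonneg_left ?_ (by positivity)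
          exact mul_le_mul_of_nonneg_right e4 (by positivity)
      _ = CL * K ^ NL * (‖w‖ * (1 + ‖w‖) ^ NL) * ‖τ‖ ^ (D - 1) := by ring
      _ ≤ CL * K ^ NL * (1 + ‖w‖) ^ Ntot * ‖τ‖ ^ (D - 1) := by
          refine mul_le_mul_of_nonneg_right ?_ (by positivity)
          exact mul_le_mul_of_nonneg_left e5 (by positivity)
  calc ‖(∑ i ∈ Finset.range D, τ ^ i * eval (κ + u) (homogeneousComponent i g)) +
        τ ^ D * (eval (κ + u) (homogeneousComponent D g) - eval κ (homogeneousComponent D g))‖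
      ≤ ‖∑ i ∈ Finset.range D, τ ^ i * eval (κ + u) (homogeneousComponent i g)‖ +
        ‖τ ^ D * (eval (κ + u) (homogeneousComponent D g) -
          eval κ (homogeneousComponent D g))‖ := norm_add_le _ _
    _ ≤ (∑ i ∈ Finset.range D, B i * K ^ NB i) * (1 + ‖w‖) ^ Ntot * ‖τ‖ ^ (D - 1) +
        CL * K ^ NL * (1 + ‖w‖) ^ Ntot * ‖τ‖ ^ (D - 1) := add_le_add hlow htop
    _ = ((∑ i ∈ Finset.range D, B i * K ^ NB i) + CL * K ^ NL) * (1 + ‖w‖) ^ Ntot *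
        ‖τ‖ ^ (D - 1) := by ring

/-! ### Choice of the escaping root: sign, angle, real part -/

/-- **Sign and angle of the escaping root.** For `α ≠ 0` and `D ≥ 1` there are a sign `σ = ±1` and
an angle `θ₀` with `|θ₀| ≤ π/(2D)` and `α (e^{iθ₀})ᴰ = iσ‖α‖`; consequently `τ₀ = r e^{iθ₀}`
satisfies `α τ₀ᴰ = 2πiσk` when `rᴰ = 2πk/‖α‖`. (Among the `2D` solutions of `α τᴰ ∈ ±i ℝ_{>0}`,
equally spaced by `π/D` in argument, one has `|arg| ≤ π/(2D)`.) [folklore] -/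
theorem exists_sign_arg_root {α : ℂ} (hα : α ≠ 0) {D : ℕ} (hD : 0 < D) :
    ∃ σ : ℝ, (σ = 1 ∨ σ = -1) ∧ ∃ θ₀ : ℝ, |θ₀| ≤ Real.pi / (2 * D) ∧
      α * exp (θ₀ * I) ^ D = I * σ * ‖α‖ := by
  set φ : ℝ := arg (I / α) with hφ
  set n : ℤ := -round (φ / Real.pi) with hn
  have hDpos : (0 : ℝ) < D := by exact_mod_cast hD
  refine ⟨(-1 : ℝ) ^ n, ?_, (φ + n * Real.pi) / D, ?_, ?_⟩
  · rcases Int.even_or_odd n with h | h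
    · exact Or.inl h.neg_one_zpow
    · exact Or.inr h.neg_one_zpow
  · have h1 : |φ / Real.pi - round (φ / Real.pi)| ≤ 1 / 2 := abs_sub_round _
    have h2 : φ + n * Real.pi = (φ / Real.pi - round (φ / Real.pi)) * Real.pi := by
      rw [hn]; push_cast; field_simp; ring
    rw [abs_div, Nat.abs_cast, h2, abs_mul, abs_of_pos Real.pi_pos,
      div_le_div_iff₀ hDpos (by positivity)]
    nlinarith [Real.pi_pos, mul_pos Real.pi_pos hDpos, abs_nonneg (φ / Real.pi - round (φ / Real.pi))]
  · have hIα : I / α ≠ 0 := div_ne_zero I_ne_zero hα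
    have hnormIα : (‖I / α‖ : ℂ) = (‖α‖ : ℂ)⁻¹ := by
      rw [norm_div, Complex.norm_I, one_div, Complex.ofReal_inv]
    have hpolar : (‖I / α‖ : ℂ) * exp (φ * I) = I / α := by
      rw [hφ]; exact norm_mul_exp_arg_mul_I (I / α)
    have hexpφ : exp (φ * I) = I / α * ‖α‖ := by
      have h0 : (‖α‖ : ℂ) ≠ 0 := by exact_mod_cast norm_ne_zero_iff.mpr hα
      rw [hnormIα] at hpolar
      calc exp (φ * I) = (‖α‖ : ℂ) * ((‖α‖ : ℂ)⁻¹ * exp (φ * I)) := by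
            rw [← mul_assoc, mul_inv_cancel₀ h0, one_mul]
        _ = I / α * ‖α‖ := by rw [hpolar, mul_comm]
    have hexpn : exp ((n * Real.pi : ℝ) * I) = (-1 : ℂ) ^ n := by
      push_cast
      rw [show (n : ℂ) * (Real.pi : ℂ) * I = n * (Real.pi * I) by ring, exp_int_mul,
        Complex.exp_pi_mul_I]
    have hD0 : (D : ℂ) ≠ 0 := by exact_mod_cast hD.ne'
    have harg : (D : ℂ) * (((φ + n * Real.pi) / D : ℝ) * I) =
        (φ : ℂ) * I + ((n * Real.pi : ℝ) : ℂ) * I := by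
      push_cast
      rw [← add_mul, ← mul_assoc, mul_div_cancel₀ _ hD0]
    rw [← Complex.exp_nat_mul, harg, Complex.exp_add, hexpφ, hexpn]
    push_cast
    field_simp

/-- Polar form of the escaping coordinate: for real `r, θ₀` and `η ∈ ℂ`,
`r e^{iθ₀} e^{η/D} = r e^{Re η / D} · e^{i(θ₀ + Im η / D)}`, so its real part is
`r e^{Re η/D} cos(θ₀ + Im η/D)` and its norm `|r| e^{Re η/D}`. [folklore] -/
theorem escape_re_norm (r θ₀ : ℝ) (η : ℂ) (D : ℕ) :
    ((r : ℂ) * exp (θ₀ * I) * exp (η / D)).re =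
        r * Real.exp (η.re / D) * Real.cos (θ₀ + η.im / D) ∧
      ‖(r : ℂ) * exp (θ₀ * I) * exp (η / D)‖ = |r| * Real.exp (η.re / D) := by
  have hsplit : exp (θ₀ * I) * exp (η / D) = exp (((η.re / D : ℝ) : ℂ) + ((θ₀ + η.im / D : ℝ) : ℂ) * I) := by
    rw [← Complex.exp_add]
    congr 1
    apply Complex.ext <;> simp [Complex.div_re, Complex.div_im]
  constructor
  · rw [mul_assoc, hsplit, Complex.re_ofReal_mul, Complex.exp_re]
    simp only [Complex.add_re, Complex.ofReal_re, Complex.mul_re, Complex.I_re, Complex.I_im,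
      Complex.ofReal_im, Complex.add_im, Complex.mul_im]
    ring_nf
  · rw [mul_assoc, hsplit, norm_mul, Complex.norm_real, Real.norm_eq_abs, Complex.norm_exp]
    simp only [Complex.add_re, Complex.ofReal_re, Complex.mul_re, Complex.I_re, Complex.I_im,
      Complex.ofReal_im]
    ring_nf

/-- **Real part of the escaping coordinate.** If `D ≥ 2`, `|θ₀| ≤ π/(2D)`, `r ≥ 0` and `‖η‖ ≤ 1`,
then `Re(r e^{iθ₀} e^{η/D}) ≥ r/12`: indeed `e^{Re η/D} ≥ e^{-1/2} ≥ 1/2` and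
`cos(θ₀ + Im η/D) ≥ 1 - (π/4 + 1/2)²/2 ≥ 1/6`. [folklore] -/
theorem re_escape_ge {D : ℕ} (hD : 2 ≤ D) {θ₀ : ℝ} (hθ₀ : |θ₀| ≤ Real.pi / (2 * D))
    {r : ℝ} (hr : 0 ≤ r) {η : ℂ} (hη : ‖η‖ ≤ 1) :
    r / 12 ≤ ((r : ℂ) * exp (θ₀ * I) * exp (η / D)).re := by
  rw [(escape_re_norm r θ₀ η D).1]
  have hDr : (2 : ℝ) ≤ D := by exact_mod_cast hD
  have hDpos : (0 : ℝ) < D := by linarith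
  have hre : |η.re| ≤ 1 := (Complex.abs_re_le_norm η).trans hη
  have him : |η.im| ≤ 1 := (Complex.abs_im_le_norm η).trans hη
  -- the exponential factor
  have hexp : 1 / 2 ≤ Real.exp (η.re / D) := by
    have h1 : -(1 / 2 : ℝ) ≤ η.re / D := by
      rw [le_div_iff₀ hDpos]
      have := (abs_le.mp hre).1
      nlinarith
    have h2 := Real.add_one_le_exp (η.re / D)
    linarith
  -- the cosine factor
  have hang : |θ₀ + η.im / D| ≤ Real.pi / 4 + 1 / 2 := by
    have h1 : |η.im / D| ≤ 1 / 2 := by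
      rw [abs_div, Nat.abs_cast, div_le_iff₀ hDpos]
      nlinarith
    have h2 : Real.pi / (2 * D) ≤ Real.pi / 4 := by
      rw [div_le_div_iff₀ (by positivity) (by norm_num)]
      nlinarith [Real.pi_pos]
    calc |θ₀ + η.im / D| ≤ |θ₀| + |η.im / D| := abs_add_le _ _
      _ ≤ Real.pi / 4 + 1 / 2 := by linarith
  have hcos : 1 / 6 ≤ Real.cos (θ₀ + η.im / D) := by
    have h1 := Real.one_sub_sq_div_two_le_cos (x := θ₀ + η.im / D)
    have h2 : (θ₀ + η.im / D) ^ 2 ≤ (Real.pi / 4 + 1 / 2) ^ 2 := by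
      rw [← sq_abs (θ₀ + η.im / D)]
      exact pow_le_pow_left₀ (abs_nonneg _) hang 2
    have h3 : (Real.pi / 4 + 1 / 2) ^ 2 ≤ 5 / 3 := by nlinarith [Real.pi_lt_d2, Real.pi_pos]
    linarith
  calc r / 12 = r * (1 / 2) * (1 / 6) := by ring
    _ ≤ r * Real.exp (η.re / D) * Real.cos (θ₀ + η.im / D) :=
        mul_le_mul (mul_le_mul_of_nonneg_left hexp hr) hcos (by norm_num) (by positivity)

/-- **Size of the escaping coordinate.** If `D ≥ 2`, `r ≥ 0` and `‖η‖ ≤ 1`, then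
`r/2 ≤ ‖r e^{iθ₀} e^{η/D}‖ ≤ 2r`. [folklore] -/
theorem norm_escape_le {D : ℕ} (hD : 2 ≤ D) (θ₀ : ℝ) {r : ℝ} (hr : 0 ≤ r) {η : ℂ} (hη : ‖η‖ ≤ 1) :
    r / 2 ≤ ‖(r : ℂ) * exp (θ₀ * I) * exp (η / D)‖ ∧
      ‖(r : ℂ) * exp (θ₀ * I) * exp (η / D)‖ ≤ 2 * r := by
  rw [(escape_re_norm r θ₀ η D).2, abs_of_nonneg hr]
  have hDr : (2 : ℝ) ≤ D := by exact_mod_cast hD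
  have hDpos : (0 : ℝ) < D := by linarith
  have hre : |η.re| ≤ 1 := (Complex.abs_re_le_norm η).trans hη
  have hlo : -(1 / 2 : ℝ) ≤ η.re / D := by
    rw [le_div_iff₀ hDpos]; have := (abs_le.mp hre).1; nlinarith
  have hhi : η.re / D ≤ 1 / 2 := by
    rw [div_le_iff₀ hDpos]; have := (abs_le.mp hre).2; nlinarith
  constructor
  · have h2 := Real.add_one_le_exp (η.re / D)
    nlinarith
  · have hexp2 : Real.exp (1 / 2) ≤ 2 := by
      have h : Real.exp (1 / 2) * Real.exp (1 / 2) = Real.exp 1 := by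
        rw [← Real.exp_add]; norm_num
      have h1 := Real.exp_one_lt_d9
      nlinarith [Real.exp_pos (1 / 2 : ℝ)]
    have h2 : Real.exp (η.re / D) ≤ 2 := (Real.exp_le_exp.mpr hhi).trans hexp2
    nlinarith

/-- `(1 + u)ᴺ e^{-u/12} → 0` as `u → ∞`. [folklore] -/
theorem tendsto_one_add_pow_mul_exp_neg_div (N : ℕ) :
    Tendsto (fun u : ℝ => (1 + u) ^ N * Real.exp (-(u / 12))) atTop (𝓝 0) := by
  have h1 := Real.tendsto_pow_mul_exp_neg_atTop_nhds_zero N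
  have h2 : Tendsto (fun u : ℝ => (1 + u / 12) ^ N * Real.exp (-(1 + u / 12))) atTop (𝓝 0) :=
    h1.comp (tendsto_atTop_add_const_left _ 1 (tendsto_id.atTop_div_const (by norm_num)))
  have h3 : Tendsto (fun u : ℝ => (12 : ℝ) ^ N * Real.exp 1 *
      ((1 + u / 12) ^ N * Real.exp (-(1 + u / 12)))) atTop (𝓝 0) := by
    have := h2.const_mul ((12 : ℝ) ^ N * Real.exp 1); rwa [mul_zero] at this
  refine squeeze_zero_norm' ?_ h3
  filter_upwards [eventually_ge_atTop (0 : ℝ)] with u hu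
  rw [Real.norm_of_nonneg (by positivity)]
  have e1 : (1 + u) ^ N ≤ (12 : ℝ) ^ N * (1 + u / 12) ^ N := by
    rw [← mul_pow]; exact pow_le_pow_left₀ (by positivity) (by linarith) N
  have e2 : Real.exp (-(u / 12)) = Real.exp 1 * Real.exp (-(1 + u / 12)) := by
    rw [← Real.exp_add]; ring_nf
  rw [e2]
  calc (1 + u) ^ N * (Real.exp 1 * Real.exp (-(1 + u / 12)))
      ≤ (12 : ℝ) ^ N * (1 + u / 12) ^ N * (Real.exp 1 * Real.exp (-(1 + u / 12))) :=
        mul_le_mul_of_nonneg_right e1 (by positivity)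
    _ = (12 : ℝ) ^ N * Real.exp 1 * ((1 + u / 12) ^ N * Real.exp (-(1 + u / 12))) := by ring

end Summit.Schanuel.Schanuel.Theorems
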